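import Literature.NumberTheory.EllipticCurves.Delbourgo1998.RankZeroLeadingTerm
import HarnessLib

/-!
# Delbourgo 1998, Thm. 3 + Prop. 4 + §2.2 Lemma (ii): the rank-zero algebraic leading term of `X(E/ℚ_∞)`
# at an additive, POTENTIALLY MULTIPLICATIVE prime — EXACT up to a `p`-adic unit (named fact)

Topic `NumberTheory/EllipticCurves`, sub-directory `Delbourgo1998` (namespace = path). ONE named fact
(`def … : Prop`, D-0014) and nothing else; sequel of `Delbourgo1998/RankZeroLeadingTerm.lean`, whose
fact `prop4_rankZero_pow_dvd_constantCoeff` transcribes ONE direction of Prop. 4 (a divisibility,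
weaker than print, on both the (G)-ordinary and the (M) locus). Written for the residual cell
`b2b-bsdres`, team n1011 (N10: the LOWER half `ord_p #Ш_an ≤ ord_p #Ш` at an additive prime), seat
`b2b-bsdres-n1011-p18`: the lower half needs the OTHER direction of Prop. 4, i.e. the printed
EQUIVALENCE up to a `p`-adic unit, which on the potentially multiplicative locus carries NO
`H¹`-factor by the Lemma of §2.2 (ii). Only that locus is transcribed here (on the (G)-ordinary locus
the `H¹`-factor `#F(𝔽_p)(p)·#R(E(ℚ_p))(p)` of Lemma (i) needs vocabulary the tree does not have and
its reading is discussed in `Summit.….Additive.GordCycLeadingTerm`; it is NOT transcribed).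

## The printed statements (D. Delbourgo, *Iwasawa theory for elliptic curves at unstable primes*,
Compositio Math. 113 (1998) 123–154; held text `paper:delbourgo1998-…`, pages as printed)

* p. 123: `p` an odd prime; `ℚ_∞` the cyclotomic `ℤ_p`-extension, `Γ = Gal(ℚ_∞/ℚ)`, `Λ = ℤ_p⟦Γ⟧ ≅ ℤ_p⟦T⟧`
  (`γ ↦ 1 + T`, p. 151); §2.1 (pp. 136–137): `S(E/ℚ_∞)` the CLASSICAL Selmer group, `X_∞` its
  Pontryagin dual (the tree's `SelmerDualData`, as in the sibling file).
* §1.6 (p. 133) **Hypothesis (M)**: "`E` has potential multiplicative reduction at `p`, and hence `E`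
  possesses (bad) multiplicative reduction over a field `L ⊂ ℚ_p(μ_p)` where `[L : ℚ_p] = 1` or `2`"
  (⇔ `ord_p j_E < 0`).
* §2.2 **Lemma (ii)** (p. 139): "Assume `E` satisfies (M) and does not have split multiplicative
  reduction over `ℚ_p`. Then `#H¹(ℚ_{∞,p}/ℚ_p, E(ℚ_{∞,p}))(p) = 1`." (Proof, pp. 139–140: `E ≅ E^{(δ)}`
  over a quadratic `F′/ℚ_p`, `E^{(δ)}` split multiplicative — every ADDITIVE curve of type (M) is covered.)
* §2.3 (p. 143) **Hypothesis (Kol)**: "`E` is modular and its analytic rank `r_E` is zero. … (Kol)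
  implies the finiteness of both `E(ℚ)` and the Tate–Shafarevic group."
* **Theorem 3** (p. 143): "Assume that either `E` has potential good ordinary reduction at `p` and
  satisfies (G), or `E` satisfies (M) and does not have split multiplicative reduction at `p`. Moreover
  suppose that `E` satisfies the hypothesis (Kol). Then the module `X_∞` is `Λ`-torsion. If `G_E`
  denotes its characteristic power series then the leading term `x_p^0(G_E) ≠ 0`."
* **Proposition 4** (p. 144): same hypotheses; "Then
  `x_p^0(G_E) ∼ #Ш_E(p) · #E(ℚ)^{−2} · #H¹(ℚ_{∞,p}/ℚ_p, E(ℚ_{∞,p})) · ∏_{ν ≠ p} c_ν`,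
  where `Ш_E` is the Tate–Shafarevic group of `E` over `ℚ`, with `∼` denoting equivalence up to a
  `p`-adic unit."

## The fact below (case (M); as printed, up to the choice of generator)

`x_p^0(G_E) = G_E(0)` is the constant term of the characteristic power series, a GENERATOR of the
characteristic ideal `char_Λ X_∞` (principal: `Λ` is a UFD; tree `charIdeal_isPrincipal_holds`). On
the (M) locus without split multiplicative reduction over `ℚ_p` — automatic for an ADDITIVE curve —
the `H¹`-factor has trivial `p`-part (Lemma (ii)), and the prime-to-`p` parts of `#E(ℚ)²`, `#H¹` and
`∏_{ν≠p} c_ν` are `p`-adic units, so Prop. 4 reads: there is a generator `g` of `char_Λ X(E/ℚ_∞)` and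
a unit `u ∈ ℤ_p^×` with `g(0) · #E(ℚ)² = u · #Ш_E(p) · ∏_{ν≠p} c_ν` in `ℤ_p`. This is what is typed —
BOTH directions of Prop. 4 on the (M) locus (the sibling fact keeps only `p^{…} ∣ g(0)·#E(ℚ)²`).
Hypotheses, weaker than print: `p ≠ 2`; `E` ADDITIVE at `p` with `ord_p j_E < 0` ((M)); (Kol) as
`r_an = 0` (modularity is a theorem) PLUS `Ш(E/ℚ)` and `E(ℚ)` finite as explicit binders; `κ` the
cyclotomic `ℤ_p`-extension with topological generator `γ`, `D : W.SelmerDualData κ γ`. Conclusion: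
`D.IsTorsion` (Thm. 3) and the displayed identity for some `g` with `D.charIdeal = (g)`, with
`∏_{ν≠p} c_ν` the `finprod` of the tree's `tamagawaNumberAt` away from `p` (same term as the sibling
fact), `#E(ℚ) = Nat.card W.toAffine.Point`, `#Ш_E(p) = Nat.card` of the `p`-primary component of
`W.sha`. No `_holds` (size L: Perrin-Riou / Coates–Greenberg control at an unstable prime).

## References
* D. Delbourgo, Compositio Math. 113 (1998) 123–154, §1.6 (M) (p. 133), §2.1 (p. 136), §2.2 Lemma (ii)
  (p. 139), Thm. 3 (p. 143), Prop. 4 (p. 144). [Delbourgo1998]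
* R. Greenberg, LNM 1716 (1999), §1 (the cyclotomic Iwasawa module; tree `SelmerDualData`). [GreenbergLNM1716]
-/

noncomputable section

open scoped Classical NumberField

open IsDedekindDomain NumberField WeierstrassCurve

namespace Literature.NumberTheory.EllipticCurves.Delbourgo1998

/-- **Delbourgo 1998, Thm. 3 + Prop. 4 + §2.2 Lemma (ii) (rank-zero leading term at an additive,
potentially multiplicative prime, EXACT up to a `p`-adic unit).** Let `W/ℚ` be a globally minimal
elliptic curve, `p ≠ 2` a prime of ADDITIVE reduction with `ord_p j_E < 0` (hypothesis (M); an
additive curve "does not have split multiplicative reduction over `ℚ_p`"); assume `r_an(E) = 0`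
((Kol)) and, as binders, `Ш(E/ℚ)` and `E(ℚ)` finite. Let `κ` be the cyclotomic `ℤ_p`-extension of
`ℚ`, `γ` a topological generator, `D` a Pontryagin-dual datum of `Sel_{p^∞}(E/ℚ_∞)`. Then `X(E/ℚ_∞)`
is `Λ`-torsion and its characteristic ideal has a generator `g` (the characteristic power series
`G_E`) with `g(0) · #E(ℚ)² = u · #Ш(E)(p) · ∏_{ν≠p} c_ν` in `ℤ_p` for a unit `u ∈ ℤ_p^×` — Prop. 4
`x_p^0(G_E) ∼ #Ш_E(p)·#E(ℚ)^{−2}·#H¹(ℚ_{∞,p}/ℚ_p, E(ℚ_{∞,p}))·∏_{ν≠p} c_ν` with `#H¹(…)(p) = 1` by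
Lemma (ii). No `_holds`.
[cite: Delbourgo1998, Prop. 4 (p. 144), Thm. 3 (p. 143) and §2.2 Lemma (ii) (p. 139), with §1.6 (M) (p. 133), §2.1 (p. 136), §2.3 (Kol) (p. 143)] -/
def prop4_rankZero_constantCoeff_eq_unit_mul_of_potMult : Prop :=
  ∀ (W : WeierstrassCurve ℚ) [W.IsElliptic] [W.IsGloballyMinimal] (p : ℕ) [Fact p.Prime],
    p ≠ 2 →
    (¬ W.HasGoodReductionAtPrime p ∧ ¬ W.HasMultiplicativeReductionAtPrime p) →
    padicValRat p W.j < 0 →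
    W.analyticRank = 0 → Finite W.sha → Finite W.toAffine.Point →
    ∀ (κ : ZpExtension ℚ p) (γ : Field.absoluteGaloisGroup ℚ),
      κ.IsCyclotomic → κ.IsTopGenerator γ →
      ∀ D : W.SelmerDualData κ γ,
        D.IsTorsion ∧
        ∃ g ∈ D.charIdeal, D.charIdeal = Ideal.span {g} ∧ ∃ u : ℤ_[p]ˣ,
          PowerSeries.constantCoeff g * ((Nat.card W.toAffine.Point : ℕ) : ℤ_[p]) ^ 2 =
            (u : ℤ_[p]) * ((Nat.card (AddCommGroup.primaryComponent W.sha p) : ℕ) : ℤ_[p]) *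
              ((∏ᶠ v : HeightOneSpectrum (𝓞 ℚ),
                  if (p : 𝓞 ℚ) ∈ v.asIdeal then 1 else W.tamagawaNumberAt v : ℕ) : ℤ_[p])

end Literature.NumberTheory.EllipticCurves.Delbourgo1998

end
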